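import Summits.CriticalPhenomena.PercolationContinuityZ3.Theorems.PercNearOneGluingAdditiveGluingSetObserverPreMargin
import Summits.CriticalPhenomena.PercolationContinuityZ3.Theorems.PercNearOneGluingAdditiveGluingSetObserverMargBound
import HarnessLib

/-!
# Conjecture G / SET-W via a SET observer, XXI: THEOREM 2-set ROBUST in the minimality of the designated relay

Support file (`--supports stmt-CriticalPhenomena-4576`); no definitions, no named facts, no sorries.  Seat (b) V⁺-form `png-dp-vplus`, gen 13
(memo MEMO-gen13.md §3: the weight-`1` closure needs a `δ`-approximate argmin).  Copy of gen 12's `CSHSet.preMarginSet_nonneg_of_cshSet` with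
`m_c ≤ m_a` weakened to `m_c ≤ m_a + δ` (`δ ≥ 0`) and the conclusion weakened to `Marg ≥ −δ·|X|·2^{|X|+|D|}`: the only use of minimality,
`J ≥ −Δ_k(X')`, becomes `J ≥ −Δ_k(X') − δ` and costs `δ·Marg[c_k] ≤ δ·2^{|D|+1}` per peeled relay (bounds from `…SetObserverMargBound.lean`).
* **`preMarginSet_ge_of_cshSet_approx`** — Theorem 2-set with a `δ`-approximate argmin.
[cite: KozmaNitzan2024, Conj. 4 (p. 32)] [cite: VandenbergHaggstromKahn2005, §2.1 Lemma 2.4 (p. 10)]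
-/

noncomputable section

namespace Summit.CriticalPhenomena.PercolationContinuityZ3.Theorems

open MeasureTheory Set Literature.Probability.LatticeModels Literature.Probability.Percolation
open scoped Classical

namespace CSHSet

open KNPreFKG CSH PreFKGSurplus SetSurplus

variable {n : ℕ}

/-! ### Theorem 2-set with an approximate argmin -/

/-- **(pS5D)-set from CSH-set, ROBUST in the minimality of `c`**: as `CSHSet.preMarginSet_nonneg_of_cshSet`, but assuming only
`m_c ≤ m_a + δ` for `a ∈ X` (`δ ≥ 0`); the set pre-FKG surplus margin is then `≥ −δ·|X|·2^{|X|+|D|}`.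
(transcription of the cell memo png-dp-vplus MEMO-gen13.md §3) [cite: KozmaNitzan2024, Conj. 4 (p. 32)] [cite: VandenbergHaggstromKahn2005, §2.1 Lemma 2.4 (p. 10)] -/
theorem preMarginSet_ge_of_cshSet_approx (w : Sym2 (Fin n) → unitInterval) (hw : ∀ e, w e < 1) (O : Finset (Fin n)) (v : Fin n)
    (r : Fin n → ℕ) (δ : ℝ) (hδ : 0 ≤ δ)
    (hCSH : ∀ (x : Fin n) (Y : Finset (Fin n)) (D : List (Fin n)),
      x ∉ Y → v ≠ x → v ∉ Y → D.Nodup → (∀ d ∈ D, d ≠ x ∧ d ∉ Y ∧ d ≠ v) →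
      (∀ o ∈ O, o ≠ x ∧ o ∉ Y ∧ o ≠ v ∧ o ∉ D) → CSHSetHolds w x (↑Y : Set (Fin n)) D O v) :
    ∀ (X : Finset (Fin n)) (c : Fin n) (D : List (Fin n)) (F : Set (Fin n) → ℝ),
      (∀ S S' : Set (Fin n), S ⊆ S' → F S ≤ F S') → c ∈ X →
      (∀ a ∈ X, ∫ ω, F (openCluster ω c) ∂(prodBernoulli w) ≤ (∫ ω, F (openCluster ω a) ∂(prodBernoulli w)) + δ) →
      (∀ a ∈ X, a ≠ c → r c < r a) → Set.InjOn r ↑X →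
      v ∉ X → D.Nodup → (∀ d ∈ D, d ∉ X ∧ d ≠ v) → (∀ o ∈ O, o ∉ X ∧ o ≠ v ∧ o ∉ D) →
      -(δ * (X.card : ℝ) * 2 ^ (X.card + D.length)) ≤
        cshMarg (decoyListSet w O (↑X : Set (Fin n)) D) (obsConstSet w O v ((↑X : Set (Fin n)) ∪ {d | d ∈ D})) none (some v)
          (preSurplusSet w O X r F c) := by
  classical
  have main : ∀ (N : ℕ) (X : Finset (Fin n)) (c : Fin n) (D : List (Fin n)) (F : Set (Fin n) → ℝ), X.card = N →
      (∀ S S' : Set (Fin n), S ⊆ S' → F S ≤ F S') → c ∈ X →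
      (∀ a ∈ X, ∫ ω, F (openCluster ω c) ∂(prodBernoulli w) ≤ (∫ ω, F (openCluster ω a) ∂(prodBernoulli w)) + δ) →
      (∀ a ∈ X, a ≠ c → r c < r a) → Set.InjOn r ↑X →
      v ∉ X → D.Nodup → (∀ d ∈ D, d ∉ X ∧ d ≠ v) → (∀ o ∈ O, o ∉ X ∧ o ≠ v ∧ o ∉ D) →
      -(δ * (X.card : ℝ) * 2 ^ (X.card + D.length)) ≤
        cshMarg (decoyListSet w O (↑X : Set (Fin n)) D) (obsConstSet w O v ((↑X : Set (Fin n)) ∪ {d | d ∈ D})) none (some v)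
          (preSurplusSet w O X r F c) := by
    intro N
    induction N using Nat.strong_induction_on with
    | _ N ih =>
    intro X c D F hN hF hcX hcmin hrc hr hvX hD hDX hOX
    set μ := prodBernoulli w with hμ
    have hmeas : ∀ S : Set (BondConfig (Fin n)), MeasurableSet S := fun _ => MeasurableSet.of_discrete
    have hint : ∀ (g : BondConfig (Fin n) → ℝ), Integrable g μ := fun g => Integrable.of_finite
    have hn := fun (S : Set (BondConfig (Fin n))) => (measureReal_nonneg : 0 ≤ μ.real S)
    have hvc : v ≠ c := fun h => hvX (h ▸ hcX)
    set PS : Finset (Fin n) → (Option (Fin n) → ℝ) := fun Z => preSurplusSet w O Z r F c with hPS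
    rcases (X.erase c).eq_empty_or_nonempty with h0 | hne
    · -- base: `X = {c}`, `Δ ≡ 0`
      have hXc : X = {c} := by rw [← Finset.insert_erase hcX, h0]; rfl
      have hzero : PS X = fun _ => 0 := by
        funext s
        cases s with
        | none =>
          simp only [hPS, preSurplusSet_none, hXc, Finset.sum_singleton]
          rw [setIntegral_congr_fun (hmeas _) (g := fun _ => (0 : ℝ)) (fun ω _ => by simp)]
          simp
        | some u =>
          simp only [hPS, preSurplusSet_some, hXc]
          have hU : (⋃ a ∈ ({c} : Finset (Fin n)), (openConn u a : Set (BondConfig (Fin n)))) = openConn u c := by ext ω; simp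
          rw [hU, setIntegral_congr_fun (hmeas _) (g := fun _ => (0 : ℝ)) (fun ω hω => by
            show F (openCluster ω u) - F (openCluster ω c) = 0
            rw [openCluster_eq_of_reach (show (openGraph ω).Reachable u c from hω), sub_self])]
          simp
      show -(δ * (X.card : ℝ) * 2 ^ (X.card + D.length)) ≤ cshMarg _ _ none (some v) (PS X)
      rw [hzero, show (fun _ : Option (Fin n) => (0 : ℝ)) = (0 : Option (Fin n) → ℝ) from rfl, cshMarg_zero, neg_nonpos]
      positivity
    -- step: peel the rank-maximal relay `k ≠ c`
    obtain ⟨k, hk, hkmax⟩ := Finset.exists_max_image (X.erase c) r hne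
    have hkc : k ≠ c := (Finset.mem_erase.1 hk).1
    have hkX : k ∈ X := (Finset.mem_erase.1 hk).2
    have hmax : ∀ a ∈ X, a ≠ k → r a < r k := by
      intro a ha hak
      by_cases hac : a = c
      · rw [hac]; exact hrc k hkX hkc
      · exact lt_of_le_of_ne (hkmax a (Finset.mem_erase.2 ⟨hac, ha⟩))
          fun h => hak (hr (Finset.mem_coe.2 ha) (Finset.mem_coe.2 hkX) h)
    set X' : Finset (Fin n) := X.erase k with hX'
    have hXcard : X'.card < N := by
      rw [hX', Finset.card_erase_of_mem hkX]; have := Finset.card_pos.2 ⟨k, hkX⟩; omega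
    have hX'X : ∀ a ∈ X', a ∈ X := fun a ha => Finset.mem_of_mem_erase ha
    have hkX' : k ∉ X' := Finset.notMem_erase k X
    have hcX' : c ∈ X' := Finset.mem_erase.2 ⟨hkc.symm, hcX⟩
    have hkv : v ≠ k := fun h => hvX (h ▸ hkX)
    have hkD : k ∉ D := fun h => (hDX k h).1 hkX
    have hkO : k ∉ O := fun h => (hOX k h).1 hkX
    have hmk : ∫ ω, F (openCluster ω c) ∂μ ≤ (∫ ω, F (openCluster ω k) ∂μ) + δ := hcmin k hkX
    -- the objects
    set Dk : Set (BondConfig (Fin n)) := {ω : BondConfig (Fin n) | ∀ a ∈ (↑X' : Set (Fin n)), ¬ (openGraph ω).Reachable k a}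
      with hDk
    set EO : Set (BondConfig (Fin n)) := obsEv O k (↑X' : Set (Fin n)) with hEO
    have hEO' : EO = {ω : BondConfig (Fin n) | ∃ o ∈ O, (openGraph ω).Reachable o k} ∩
        {ω | ∀ o ∈ O, ∀ a ∈ X', ¬ (openGraph ω).Reachable o a} := by
      rw [hEO, obsEv]; ext ω; simp only [Finset.mem_coe]
    have hEODk : EO ⊆ Dk := obsEv_subset_avoid O k _
    have hDkEO : Dk ∩ EO = EO := inter_eq_self_of_subset_right hEODk
    set gk : BondConfig (Fin n) → ℝ := fun ω => F (openCluster ω k) - F (openCluster ω c) with hgk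
    set L := decoyListSet w O (↑X : Set (Fin n)) D with hL
    set p : ℝ := obsConstSet w O v ((↑X : Set (Fin n)) ∪ {d | d ∈ D}) with hp
    set ck : Option (Fin n) → ℝ := avoidConstSet w O k (↑X' : Set (Fin n)) with hck
    set Gk : Set (Sym2 (Fin n)) → ℝ := fun K => F {z | z = k ∨ ∃ e ∈ K, z ∈ e} -
      ∫ η, F (openCluster (η \ BHK2006.barOf {k} K) c) ∂μ with hGk
    have hGk_mono : Monotone Gk := CovTau.monotone_projFun w c k F hF
    set Tk : Option (Fin n) → ℝ := fun s => ∫ ω in Dk ∩ slotEv O k (↑X' : Set (Fin n)) s, gk ω ∂μ with hTk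
    set Tk' : Option (Fin n) → ℝ := fun s => match s with
      | none => ∫ ω in EO, Gk (openEdgeCluster ω k) ∂μ
      | some u => ∫ ω in Dk ∩ openConn k u, gk ω ∂μ with hTk'
    set J : ℝ := ∫ ω in Dk, gk ω ∂μ with hJ
    -- positivity of the conditioning events (weights `< 1`)
    have hempty_Dk : (∅ : BondConfig (Fin n)) ∈ Dk := by
      intro a ha h
      rw [HullPort.reachable_empty_iff] at h
      exact hkX' (h ▸ (Finset.mem_coe.1 ha))
    have hDkpos : 0 < μ.real Dk := prodBernoulli_real_pos_of_empty_mem w hw hempty_Dk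
    have hisopos : 0 < μ.real (Dk ∩ {ω | openEdgeCluster ω k = ∅}) :=
      prodBernoulli_real_pos_of_empty_mem w hw (C := Dk ∩ {ω | openEdgeCluster ω k = ∅}) ⟨hempty_Dk, subset_empty_iff.1 (openEdgeCluster_subset ∅ k)⟩
    -- set identities between the systems `(X; D)`, `(X'; k; D)` and `(X'; k :: D)`
    have hins : insert k (↑X' : Set (Fin n)) = ↑X := by
      rw [hX', Finset.coe_erase, insert_sdiff_singleton, insert_eq_of_mem (Finset.mem_coe.2 hkX)]
    have hset2 : (↑X' : Set (Fin n)) ∪ {d | d ∈ k :: D} = (↑X : Set (Fin n)) ∪ {d | d ∈ D} := by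
      ext a
      simp only [mem_union, Finset.mem_coe, hX', Finset.mem_erase, mem_setOf_eq, List.mem_cons]
      constructor
      · rintro (⟨_, ha⟩ | rfl | ha)
        · exact Or.inl ha
        · exact Or.inl hkX
        · exact Or.inr ha
      · rintro (ha | ha)
        · by_cases hak : a = k
          · exact Or.inr (Or.inl hak)
          · exact Or.inl ⟨hak, ha⟩
        · exact Or.inr (Or.inr ha)
    have hcshMargin : ∀ f : Set (Sym2 (Fin n)) → ℝ,
        cshMarginSet w k (↑X' : Set (Fin n)) D O v f = cshMarg L p none (some v) (covDSet w k (↑X' : Set (Fin n)) f O) := by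
      intro f
      rw [cshMarginSet, hins]
    have hnext : cshMarg (decoyListSet w O (↑X' : Set (Fin n)) (k :: D)) (obsConstSet w O v ((↑X' : Set (Fin n)) ∪ {d | d ∈ k :: D}))
        none (some v) (PS X') = cshMarg L p none (some v) (PS X') - PS X' (some k) * cshMarg L p none (some v) ck := by
      rw [hset2, decoyListSet_cons, hins, cshMarg_cons]
    -- (1) peel `k` (both kinds of slots)
    have hpeel : PS X = PS X' + Tk := by
      funext s
      rw [Pi.add_apply]
      cases s with
      | none =>
        simp only [hPS, preSurplusSet_none, hTk, slotEv_none]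
        rw [hDkEO, hEO', setPreSurplus_erase_add w O X r F c k hkX hmax]
      | some u =>
        simp only [hPS, preSurplusSet_some, hTk, slotEv_some]
        exact preSurplus_erase_add w X F c k u hkX
    -- (2) tower on vertex slots; projection INEQUALITY on the set slot
    have hDk_S : ∀ u : Fin n, Dk ∩ openConn k u =
        {ω : BondConfig (Fin n) | ¬ (openGraph ω).Reachable k c} ∩
          {ω | openEdgeCluster ω k ∈ {K : Set (Sym2 (Fin n)) |
            (∀ a ∈ X', a ≠ c → ¬ (a = k ∨ ∃ e ∈ K, a ∈ e)) ∧ (u = k ∨ ∃ e ∈ K, u ∈ e)}} := by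
      intro u; ext ω
      simp only [mem_inter_iff, hDk, mem_setOf_eq, Finset.mem_coe]
      constructor
      · rintro ⟨h1, h2⟩
        refine ⟨h1 c hcX', fun a ha _ => ?_, (reachable_iff_exists_mem_openEdgeCluster ω k u).1 h2⟩
        rw [← reachable_iff_exists_mem_openEdgeCluster]; exact h1 a ha
      · rintro ⟨h1, h2, h3⟩
        refine ⟨fun a ha => ?_, (reachable_iff_exists_mem_openEdgeCluster ω k u).2 h3⟩
        by_cases hac : a = c
        · rw [hac]; exact h1
        · rw [reachable_iff_exists_mem_openEdgeCluster]; exact h2 a ha hac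
    have hDk_0 : Dk = {ω : BondConfig (Fin n) | ¬ (openGraph ω).Reachable k c} ∩
          {ω | openEdgeCluster ω k ∈ {K : Set (Sym2 (Fin n)) | ∀ a ∈ X', a ≠ c → ¬ (a = k ∨ ∃ e ∈ K, a ∈ e)}} := by
      ext ω
      simp only [mem_inter_iff, hDk, mem_setOf_eq, Finset.mem_coe]
      constructor
      · intro h1
        refine ⟨h1 c hcX', fun a ha _ => ?_⟩
        rw [← reachable_iff_exists_mem_openEdgeCluster]; exact h1 a ha
      · rintro ⟨h1, h2⟩ a ha
        by_cases hac : a = c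
        · rw [hac]; exact h1
        · rw [reachable_iff_exists_mem_openEdgeCluster]; exact h2 a ha hac
    have towU : ∀ u : Fin n, Tk' (some u) = ∫ ω in Dk ∩ openConn k u, Gk (openEdgeCluster ω k) ∂μ := by
      intro u
      show (∫ ω in Dk ∩ openConn k u, gk ω ∂μ) = _
      simp only [hgk]
      rw [hDk_S u]
      exact CovTau.setIntegral_sub_eq_projFun w c k F _
    have tow0 : J = ∫ ω in Dk, Gk (openEdgeCluster ω k) ∂μ := by
      simp only [hJ, hgk]
      rw [hDk_0]
      exact CovTau.setIntegral_sub_eq_projFun w c k F _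
    have hTkTk' : ∀ s, Tk' s ≤ Tk s := by
      intro s
      cases s with
      | none =>
        show (∫ ω in EO, Gk (openEdgeCluster ω k) ∂μ) ≤ ∫ ω in Dk ∩ slotEv O k (↑X' : Set (Fin n)) none, gk ω ∂μ
        rw [slotEv_none, hDkEO, hEO']
        exact setIntegral_obs_peel_ge_projFun w X' O F hF c k hcX'
      | some u => exact le_rfl
    -- the total `J = (m_k − m_c) − Δ_k(X')`
    have hJtot : J = ((∫ ω, F (openCluster ω k) ∂μ) - ∫ ω, F (openCluster ω c) ∂μ) - PS X' (some k) := by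
      have h1 := integral_add_compl (hmeas Dk) (hint gk)
      have hDkc : Dkᶜ = ⋃ a' ∈ X', (openConn k a' : Set (BondConfig (Fin n))) := by
        ext ω
        rw [mem_iUnion_openConn, mem_compl_iff, hDk]
        simp only [mem_setOf_eq, Finset.mem_coe, not_forall, not_not, exists_prop]
      have h2 : ∫ ω in Dkᶜ, gk ω ∂μ = PS X' (some k) := by
        rw [hDkc]; rfl
      have h3 : ∫ ω, gk ω ∂μ = (∫ ω, F (openCluster ω k) ∂μ) - ∫ ω, F (openCluster ω c) ∂μ := by
        rw [hgk, integral_sub (hint _) (hint _)]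
      rw [hJ]; linarith
    -- (2') the projected peeled term through `covDSet`
    have hTk_cov : (μ.real Dk) • Tk' = covDSet w k (↑X' : Set (Fin n)) Gk O + J • ((μ.real Dk) • ck) := by
      funext s
      simp only [Pi.add_apply, Pi.smul_apply, smul_eq_mul]
      have h2 : μ.real (Dk ∩ slotEv O k (↑X' : Set (Fin n)) s) = μ.real Dk * ck s := by
        simp only [hck, avoidConstSet, hDk]
        rw [mul_div_cancel₀ _ (ne_of_gt hDkpos)]
      cases s with
      | none =>
        have e : Tk' none = ∫ ω in Dk ∩ slotEv O k (↑X' : Set (Fin n)) none, Gk (openEdgeCluster ω k) ∂μ := by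
          show (∫ ω in EO, Gk (openEdgeCluster ω k) ∂μ) = _
          rw [slotEv_none, hDkEO]
        rw [e]
        unfold covDSet
        rw [← hDk, ← tow0, h2]
        ring
      | some u =>
        rw [slotEv_some] at h2
        rw [towU u, covDSet_some]
        unfold CSH.covD
        rw [← hDk, ← tow0, h2]
        ring
    -- (3) CSH-set for the peeled relay, functional `Gk`
    have hCSHk := hCSH k X' D hkX' hkv (fun h => hvX (hX'X v h)) hD
      (fun d hd => ⟨fun h => hkD (h ▸ hd), fun h => (hDX d hd).1 (hX'X d h), (hDX d hd).2⟩)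
      (fun o ho => ⟨fun h => hkO (h ▸ ho), fun h => (hOX o ho).1 (hX'X o h), (hOX o ho).2.1, (hOX o ho).2.2⟩)
    have h3 : 0 ≤ cshMarg L p none (some v) (covDSet w k (↑X' : Set (Fin n)) Gk O) := by
      rw [← hcshMargin]
      exact hCSHk Gk hGk_mono
    -- (4) Lemma AC: `Marg[c_k] ≥ 0` from CSH-set applied to `Ψ_iso`
    have h4 : 0 ≤ cshMarg L p none (some v) ck := by
      have hiso := hCSHk psiIso psiIso_mono
      rw [hcshMargin] at hiso
      have hLk : ∀ dc ∈ L, dc.1 ≠ some k := by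
        intro dc hdc h
        obtain ⟨d, hd, hd'⟩ := mem_decoyListSet w O _ D dc hdc
        rw [hd'] at h
        exact hkD ((Option.some_injective _ h) ▸ hd)
      have hcov : ∀ s : Option (Fin n), s ≠ some k → covDSet w k (↑X' : Set (Fin n)) psiIso O s =
          ((μ.real (Dk ∩ {ω | openEdgeCluster ω k = ∅}) * μ.real Dk) • ck) s := by
        intro s hs
        rw [Pi.smul_apply, smul_eq_mul]
        cases s with
        | some u =>
          have huk : u ≠ k := fun h => hs (by rw [h])
          rw [covDSet_some, covD_psiIso w X' k u huk]
          simp only [hck, avoidConstSet, hDk, slotEv_some]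
          rw [mul_assoc, mul_div_cancel₀ _ (ne_of_gt hDkpos)]
        | none =>
          -- on `EO` the cluster of `k` contains some `o ≠ k`, so `Ψ_iso(C_k) = 1`
          have h1 : ∫ ω in Dk ∩ EO, psiIso (openEdgeCluster ω k) ∂μ = μ.real (Dk ∩ EO) := by
            rw [setIntegral_congr_fun (hmeas _) (g := fun _ => (1 : ℝ)) (fun ω hω => by
              obtain ⟨⟨o, ho, hok⟩, -⟩ := (show ω ∈ EO from hω.2)
              exact psiIso_eq_one_of_reachable (fun h => hkO (h ▸ ho)) hok.symm), setIntegral_const, smul_eq_mul, mul_one]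
          have h2' : ∫ ω in Dk, psiIso (openEdgeCluster ω k) ∂μ = μ.real Dk - μ.real (Dk ∩ {ω | openEdgeCluster ω k = ∅}) := by
            have hsplit := (integral_inter_add_sdiff (hmeas {ω : BondConfig (Fin n) | openEdgeCluster ω k = ∅})
              ((hint (fun ω => psiIso (openEdgeCluster ω k))).integrableOn (s := Dk))).symm
            rw [hsplit]
            have ha : ∫ ω in Dk ∩ {ω | openEdgeCluster ω k = ∅}, psiIso (openEdgeCluster ω k) ∂μ = 0 := by
              rw [setIntegral_congr_fun (hmeas _) (g := fun _ => (0 : ℝ)) (fun ω hω => by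
                show psiIso (openEdgeCluster ω k) = (0 : ℝ)
                unfold psiIso; rw [if_pos (show openEdgeCluster ω k = ∅ from hω.2)])]
              simp
            have hb : ∫ ω in Dk \ {ω | openEdgeCluster ω k = ∅}, psiIso (openEdgeCluster ω k) ∂μ =
                μ.real (Dk \ {ω | openEdgeCluster ω k = ∅}) := by
              rw [setIntegral_congr_fun (hmeas _) (g := fun _ => (1 : ℝ)) (fun ω hω => by
                show psiIso (openEdgeCluster ω k) = (1 : ℝ)
                unfold psiIso; rw [if_neg (show ¬ (openEdgeCluster ω k = ∅) from hω.2)]), setIntegral_const, smul_eq_mul, mul_one]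
            rw [ha, hb, zero_add]
            have := measureReal_inter_add_sdiff (μ := μ) (s := Dk) (h := measure_ne_top _ _)
              (hmeas {ω : BondConfig (Fin n) | openEdgeCluster ω k = ∅})
            linarith
          unfold covDSet
          simp only [hck, avoidConstSet, slotEv_none, ← hDk, ← hEO]
          rw [h1, h2', mul_assoc, mul_div_cancel₀ _ (ne_of_gt hDkpos)]
          ring
      rw [cshMarg_congr L p none (some v) (covDSet w k (↑X' : Set (Fin n)) psiIso O)
        ((μ.real (Dk ∩ {ω | openEdgeCluster ω k = ∅}) * μ.real Dk) • ck) (fun s => s ≠ some k) hLk (Option.some_ne_none k).symm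
        (fun h => hkv (Option.some_injective _ h)) hcov, cshMarg_smul] at hiso
      exact (mul_nonneg_iff_of_pos_left (mul_pos hisopos hDkpos)).1 hiso
    -- (5) the replacement of Lemma κ: `J ≥ −Δ_k(X')` (only use of `m_c ≤ m_k`)
    have h5 : -PS X' (some k) - δ ≤ J := by rw [hJtot]; linarith [hmk]
    -- (5') a priori bound on the margin of the constants `c_k ∈ [0,1]`: `Marg[c_k] ≤ 2^{|D|+1}`
    have h4up : cshMarg L p none (some v) ck ≤ 2 ^ (D.length + 1) := by
      have hck01 : ∀ s, |ck s| ≤ 1 := fun s => by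
        rw [abs_le]
        have h0 : 0 ≤ ck s := by simp only [hck, avoidConstSet]; positivity
        have h1 : ck s ≤ 1 := by
          simp only [hck, avoidConstSet]
          exact div_le_one_of_le₀ (measureReal_mono inter_subset_left (measure_ne_top _ _)) measureReal_nonneg
        constructor <;> linarith
      have hp01 : |p| ≤ 1 := by
        rw [abs_le]
        have h0 : 0 ≤ p := by simp only [hp, obsConstSet]; positivity
        have h1 : p ≤ 1 := by
          simp only [hp, obsConstSet]
          exact div_le_one_of_le₀ (measureReal_mono (obsEv_subset_avoid O v _) (measure_ne_top _ _)) measureReal_nonneg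
        constructor <;> linarith
      have hb := abs_cshMarg_le L (decoyListSet_consts_mem w O _ D) p none (some v) ck 1 hck01
      rw [length_decoyListSet, mul_one] at hb
      have hb' : |cshMarg L p none (some v) ck| ≤ 2 * 2 ^ D.length := by
        have h2 : (1 + |p|) * (2 : ℝ) ^ D.length ≤ 2 * 2 ^ D.length := by
          have : (0 : ℝ) ≤ 2 ^ D.length := by positivity
          nlinarith
        exact hb.trans h2
      rw [pow_succ, mul_comm]
      exact (le_abs_self _).trans hb'
    -- (6) the next rung by induction
    have h6 : -(δ * (X'.card : ℝ) * 2 ^ (X'.card + (k :: D).length)) ≤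
        cshMarg (decoyListSet w O (↑X' : Set (Fin n)) (k :: D)) (obsConstSet w O v ((↑X' : Set (Fin n)) ∪ {d | d ∈ k :: D}))
        none (some v) (PS X') :=
      ih X'.card hXcard X' c (k :: D) F rfl hF hcX' (fun a ha => hcmin a (hX'X a ha))
        (fun a ha hac => hrc a (hX'X a ha) hac)
        (hr.mono (by intro a ha; exact Finset.mem_coe.2 (hX'X a (Finset.mem_coe.1 ha))))
        (fun h => hvX (hX'X v h)) (List.nodup_cons.2 ⟨hkD, hD⟩)
        (fun d hd => by
          rcases List.mem_cons.1 hd with rfl | hd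
          · exact ⟨hkX', hkv.symm⟩
          · exact ⟨fun h => (hDX d hd).1 (hX'X d h), (hDX d hd).2⟩)
        (fun o ho => ⟨fun h => (hOX o ho).1 (hX'X o h), (hOX o ho).2.1, fun h => by
          rcases List.mem_cons.1 h with h | h
          · exact hkO (h ▸ ho)
          · exact (hOX o ho).2.2 h⟩)
    -- (7) assemble: the O-slot has coefficient one, so `Marg[Tk] ≥ Marg[Tk']`
    have hTdiff : cshMarg L p none (some v) Tk - cshMarg L p none (some v) Tk' = Tk none - Tk' none := by
      rw [← cshMarg_sub]
      refine cshMarg_eq_apply_of_vanish L p none (some v) (Tk - Tk') (fun dc hdc => ?_) ?_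
      · obtain ⟨d, _, hd'⟩ := mem_decoyListSet w O _ D dc hdc
        rw [hd', Pi.sub_apply]; exact sub_eq_zero.2 rfl
      · rw [Pi.sub_apply]; exact sub_eq_zero.2 rfl
    have hTge : cshMarg L p none (some v) Tk' ≤ cshMarg L p none (some v) Tk := by
      have := hTkTk' none; linarith [hTdiff]
    have hmain : μ.real Dk * cshMarg L p none (some v) Tk' =
        cshMarg L p none (some v) (covDSet w k (↑X' : Set (Fin n)) Gk O) + J * μ.real Dk * cshMarg L p none (some v) ck := by
      rw [← cshMarg_smul, hTk_cov, cshMarg_add, cshMarg_smul, cshMarg_smul]; ring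
    have hsplit : cshMarg L p none (some v) (PS X) = cshMarg L p none (some v) (PS X') + cshMarg L p none (some v) Tk := by
      rw [hpeel, cshMarg_add]
    have hbound : μ.real Dk * cshMarg (decoyListSet w O (↑X' : Set (Fin n)) (k :: D))
        (obsConstSet w O v ((↑X' : Set (Fin n)) ∪ {d | d ∈ k :: D})) none (some v) (PS X') ≤
        μ.real Dk * (cshMarg L p none (some v) (PS X) + δ * cshMarg L p none (some v) ck) := by
      rw [hnext, hsplit]
      have e1 := mul_le_mul_of_nonneg_left hTge hDkpos.le
      have e2 := mul_le_mul_of_nonneg_right h5 (mul_nonneg hDkpos.le h4)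
      nlinarith [h3, h4, e1, e2, hmain, hDkpos.le]
    have hstep : cshMarg (decoyListSet w O (↑X' : Set (Fin n)) (k :: D))
        (obsConstSet w O v ((↑X' : Set (Fin n)) ∪ {d | d ∈ k :: D})) none (some v) (PS X') ≤
        cshMarg L p none (some v) (PS X) + δ * cshMarg L p none (some v) ck := le_of_mul_le_mul_left hbound hDkpos
    -- bookkeeping of the error: `(N-1)·2^{(N-1)+(|D|+1)} + 2^{|D|+1} ≤ N·2^{N+|D|}`
    have hcardX' : (X'.card : ℝ) = X.card - 1 := by
      rw [hX', Finset.card_erase_of_mem hkX, Nat.cast_sub (Finset.card_pos.2 ⟨k, hkX⟩)]; simp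
    have hlen : (k :: D).length = D.length + 1 := List.length_cons
    have hNpos : 1 ≤ X.card := Finset.card_pos.2 ⟨k, hkX⟩
    have hpow1 : (2 : ℝ) ^ (X'.card + (k :: D).length) = 2 ^ (X.card + D.length) := by
      rw [hlen, hX', Finset.card_erase_of_mem hkX]
      congr 1; omega
    have hpow2 : (2 : ℝ) ^ (D.length + 1) ≤ 2 ^ (X.card + D.length) :=
      pow_le_pow_right₀ (by norm_num) (by omega)
    have hpos2 : (0 : ℝ) ≤ 2 ^ (X.card + D.length) := by positivity
    show -(δ * (X.card : ℝ) * 2 ^ (X.card + D.length)) ≤ cshMarg L p none (some v) (PS X)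
    rw [hpow1, hcardX'] at h6
    have e3 : δ * cshMarg L p none (some v) ck ≤ δ * 2 ^ (X.card + D.length) :=
      mul_le_mul_of_nonneg_left (h4up.trans hpow2) hδ
    nlinarith [h6, hstep, e3, hpos2, hδ]
  intro X c D F hF hcX hcmin hrc hr hvX hD hDX hOX
  exact main X.card X c D F rfl hF hcX hcmin hrc hr hvX hD hDX hOX


end CSHSet

end Summit.CriticalPhenomena.PercolationContinuityZ3.Theorems

end
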